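import Summits.CriticalPhenomena.PercolationContinuityZ3.Theorems.PercNearOneGluingNoHeavyLowerTailSahiCombTriWKlShell

/-!
# Relabeling invariance of `TRI_W(a)` and of Kleitman shells along a bijection of the ground set

Support file of the one-cut programme (crux `NoHeavyLowerTail`, stmt-CriticalPhenomena-4575; unit `prim-lf-1` gen 41, memo
`FROM-prim-lf-1-gen41-SHELLS-AND-OR-PRODUCTS.md`).  Bookkeeping used to move strata proved on a structured ground type (a sum of blocks
`γ₁ ⊕ γ₂`, `…SahiCombTriWOrProduct`) to an arbitrary finite type `γ` with a block decomposition.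

For a bijection `e : γ ≃ δ` a family `A ⊆ Finset γ` is pushed forward to `famMap e A = {s.map e | s ∈ A} ⊆ Finset δ`.  This commutes with `∩`,
`refl`, preserves cardinalities, up-sets and monotone families, hence
* `FiveUpSet.triW_famMap` : `triW (famMap e P) (famMap e ∘ F) (famMap e ∘ G) = triW P F G`;
* `FiveUpSet.klL_famMap`, `FiveUpSet.klShell_famMap` : Kleitman sums and Kleitman shells are transported.
HONEST LABEL: pure bookkeeping, complete proofs, std axioms. [this work]
-/

namespace Summit.CriticalPhenomena.PercolationContinuityZ3.Theorems

namespace FiveUpSet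

open Finset

variable {β γ δ : Type} [DecidableEq β] [Fintype β] [DecidableEq γ] [Fintype γ] [DecidableEq δ] [Fintype δ]

/-- Push-forward of a family of sets along a bijection of the ground set. [this work] -/
def famMap (e : γ ≃ δ) (A : Finset (Finset γ)) : Finset (Finset δ) := A.map (e.finsetCongr).toEmbedding

omit [DecidableEq β] [Fintype β] [Fintype γ] [Fintype δ] [DecidableEq γ] [DecidableEq δ] in
/-- Membership in the push-forward: `s ∈ famMap e A ↔ s.map e⁻¹ ∈ A`. [this work] -/
theorem mem_famMap {e : γ ≃ δ} {A : Finset (Finset γ)} {s : Finset δ} : s ∈ famMap e A ↔ s.map e.symm.toEmbedding ∈ A := by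
  unfold famMap
  rw [mem_map_equiv, Equiv.finsetCongr_symm, Equiv.finsetCongr_apply]

omit [DecidableEq β] [Fintype β] [Fintype γ] [Fintype δ] [DecidableEq γ] [DecidableEq δ] in
/-- Membership of a point of an image set. [this work] -/
theorem mem_map_symm_iff {e : γ ≃ δ} {s : Finset δ} {a : γ} : a ∈ s.map e.symm.toEmbedding ↔ e a ∈ s := by
  rw [mem_map_equiv, Equiv.symm_symm]

omit [DecidableEq β] [Fintype β] [Fintype γ] [Fintype δ] [DecidableEq γ] [DecidableEq δ] in
/-- The push-forward preserves cardinality. [this work] -/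
theorem card_famMap (e : γ ≃ δ) (A : Finset (Finset γ)) : (famMap e A).card = A.card := card_map _

omit [DecidableEq β] [Fintype β] [Fintype γ] [Fintype δ] in
/-- The push-forward commutes with intersections. [this work] -/
theorem famMap_inter (e : γ ≃ δ) (A B : Finset (Finset γ)) : famMap e (A ∩ B) = famMap e A ∩ famMap e B := map_inter _ _

omit [DecidableEq β] [Fintype β] in
/-- Complement commutes with relabeling of a set. [this work] -/
theorem compl_map_equiv (e : γ ≃ δ) (s : Finset δ) : (s.map e.symm.toEmbedding)ᶜ = sᶜ.map e.symm.toEmbedding := by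
  ext a
  rw [mem_compl, mem_map_symm_iff, mem_map_symm_iff, mem_compl]

omit [DecidableEq β] [Fintype β] in
/-- The push-forward commutes with the antipodal image. [this work] -/
theorem refl_famMap (e : γ ≃ δ) (A : Finset (Finset γ)) : refl (famMap e A) = famMap e (refl A) := by
  ext s
  rw [mem_refl, mem_famMap, mem_famMap, mem_refl, compl_map_equiv]

omit [DecidableEq β] [Fintype β] [Fintype γ] [Fintype δ] in
/-- Triple intersections count the same after relabeling. [this work] -/
theorem card_famMap_inter₃ (e : γ ≃ δ) (A B C : Finset (Finset γ)) :
    (famMap e A ∩ famMap e B ∩ famMap e C).card = (A ∩ B ∩ C).card := by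
  rw [← famMap_inter, ← famMap_inter, card_famMap]

omit [DecidableEq β] [Fintype β] [Fintype γ] [Fintype δ] [DecidableEq γ] [DecidableEq δ] in
/-- The push-forward of an up-set is an up-set. [this work] -/
theorem isUpperSet_famMap (e : γ ≃ δ) {A : Finset (Finset γ)} (hA : IsUpperSet (A : Set (Finset γ))) :
    IsUpperSet (famMap e A : Set (Finset δ)) := by
  intro s s' hss' hs
  rw [mem_coe, mem_famMap] at hs ⊢
  exact hA (map_subset_map.2 hss') hs

omit [DecidableEq β] [Fintype β] [Fintype γ] [Fintype δ] [DecidableEq γ] [DecidableEq δ] in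
/-- The push-forward of a monotone family is monotone. [this work] -/
theorem monotone_famMap (e : γ ≃ δ) {F : Finset β → Finset (Finset γ)} (hFm : Monotone F) : Monotone fun x => famMap e (F x) :=
  fun _ _ hxy => map_subset_map.2 (hFm hxy)

/-- **Relabeling invariance of `TRI_W(a)`**: `triW (famMap e P) (famMap e ∘ F) (famMap e ∘ G) = triW P F G`. [this work] -/
theorem triW_famMap (e : γ ≃ δ) (P : Finset (Finset γ)) (F G : Finset β → Finset (Finset γ)) :
    triW (famMap e P) (fun x => famMap e (F x)) (fun x => famMap e (G x)) = triW P F G := by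
  unfold triW triWTerm
  refine sum_congr rfl fun x _ => ?_
  simp only [refl_famMap, card_famMap_inter₃]

omit [DecidableEq β] [Fintype β] in
/-- Relabeling invariance of the Kleitman sum. [this work] -/
theorem klL_famMap (e : γ ≃ δ) (T A B : Finset (Finset γ)) : klL (famMap e T) (famMap e A) (famMap e B) = klL T A B := by
  unfold klL
  rw [refl_famMap, card_famMap_inter₃, card_famMap_inter₃]

omit [DecidableEq β] [Fintype β] [Fintype γ] [Fintype δ] [DecidableEq γ] [DecidableEq δ] in
/-- Pushing forward along `e⁻¹` and then along `e` is the identity. [this work] -/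
theorem famMap_famMap_symm (e : γ ≃ δ) (A : Finset (Finset δ)) : famMap e (famMap e.symm A) = A := by
  ext s
  rw [mem_famMap, mem_famMap, Equiv.symm_symm, map_map]
  have : (e.symm.toEmbedding.trans e.toEmbedding) = Function.Embedding.refl δ := by
    ext a; simp
  rw [this, map_refl]


omit [DecidableEq β] [Fintype β] [Fintype γ] [Fintype δ] [DecidableEq γ] [DecidableEq δ] in
/-- Pushing forward along `e` and then along `e⁻¹` is the identity. [this work] -/
theorem famMap_symm_famMap (e : γ ≃ δ) (A : Finset (Finset γ)) : famMap e.symm (famMap e A) = A := by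
  have h := famMap_famMap_symm e.symm A
  rwa [Equiv.symm_symm] at h

omit [DecidableEq β] [Fintype β] in
/-- **Kleitman shells are transported by relabeling.** [this work] -/
theorem klShell_famMap (e : γ ≃ δ) {T : Finset (Finset γ)} (hT : KlShell T) : KlShell (famMap e T) := by
  intro A B hA hB
  have h := hT (famMap e.symm A) (famMap e.symm B) (isUpperSet_famMap e.symm hA) (isUpperSet_famMap e.symm hB)
  rw [← klL_famMap e, famMap_famMap_symm, famMap_famMap_symm] at h
  exact h

omit [DecidableEq β] [Fintype β] [Fintype γ] [Fintype δ] in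
/-- Relabeling commutes with union. [this work] -/
theorem famMap_union (e : γ ≃ δ) (A B : Finset (Finset γ)) : famMap e (A ∪ B) = famMap e A ∪ famMap e B := map_union _ _

/-- **`TriWIneq` transported**: if every monotone pair of up-set families over `famMap e P` has `0 ≤ triW`, so does `P`. [this work] -/
theorem triW_nonneg_of_famMap (e : γ ≃ δ) {P : Finset (Finset γ)}
    (h : ∀ F' G' : Finset β → Finset (Finset δ), (∀ x, IsUpperSet (F' x : Set (Finset δ))) → (∀ x, IsUpperSet (G' x : Set (Finset δ))) →
      Monotone F' → Monotone G' → 0 ≤ triW (famMap e P) F' G')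
    (F G : Finset β → Finset (Finset γ))
    (hF : ∀ x, IsUpperSet (F x : Set (Finset γ))) (hG : ∀ x, IsUpperSet (G x : Set (Finset γ)))
    (hFm : Monotone F) (hGm : Monotone G) :
    0 ≤ triW P F G := by
  rw [← triW_famMap e]
  exact h _ _ (fun x => isUpperSet_famMap e (hF x)) (fun x => isUpperSet_famMap e (hG x)) (monotone_famMap e hFm) (monotone_famMap e hGm)

end FiveUpSet

end Summit.CriticalPhenomena.PercolationContinuityZ3.Theorems
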